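import Summits.KontsevichZagierPeriods.KontsevichZagierPeriods.Theorems.HermiteRigidityIslandComplementCubeReflection

/-!
# `ReductionRigidity` (stmt-KontsevichZagierPeriods-3407), line `Sketch`, stub `stub_islandComplement`:
# the five-term certificate, I — the dilogarithm kernels on `□³` (`stub_fiveTermDilogPrimitives`)

Route `KontsevichZagierPeriods/HermiteRigidity`, crux `ReductionRigidity` (stmt-3407); growth deliverable
G5 of `Cruxes/ReductionRigidity/STUB-PLAN-stub_islandComplement.md` (the five-term relation of the
dilogarithm as a chain of moves), part 1. For rationals `0 < x, y < 1`, Abel's identity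

  `Li₂(x) + Li₂(y) − Li₂(xy) − Li₂(A) − Li₂(B) = log((1−x)/(1−xy)) · log((1−y)/(1−xy))`,
  `A = x(1−y)/(1−xy)`, `B = y(1−x)/(1−xy)`,

is deformed along `x ↦ sx`, `s ∈ [0,1]`. With the box kernel `k(a) = a/(1 − a·pq)` of `Li₂(a)` on
`□²` (coordinates `p = p₀`, `q = p₁`; deformation variable `s = p₂`), this file supplies the four
`s`-dependent dilogarithm kernels `K(p,q,s) = k(a(s))` for `a(s) ∈ {sx, sxy, A(s), B(s)}`
(`A(s) = sx(1−y)/(1−sxy)`, `B(s) = y(1−sx)/(1−sxy)`) together with the primitives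
`G = a′(s)·p/(1 − a(s)pq)` realising the EXACTNESS `∂ₛ k(a(s)) = ∂ₚ G` (both sides equal
`a′(s)/(1 − a(s)pq)²`), and the `s`-independent kernel `k(y)`:

* `K₁ = sx/(1 − sxpq)`,  `G₁ = xp/(1 − sxpq)`:                      `∂ₛK₁ = ∂ₚG₁ = x/(1 − sxpq)²`;
* `K₂ = sxy/(1 − sxypq)`, `G₂ = xyp/(1 − sxypq)`:                   `∂ₛK₂ = ∂ₚG₂ = xy/(1 − sxypq)²`;
* `K_A = sx(1−y)/D_A`, `G_A = x(1−y)p/((1 − sxy)D_A)`, `D_A = 1 − sxy − sx(1−y)pq`: `… = x(1−y)/D_A²`;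
* `K_B = y(1−sx)/D_B`, `G_B = −xy(1−y)p/((1 − sxy)D_B)`, `D_B = 1 − sxy − y(1−sx)pq`: `… = −xy(1−y)/D_B²`;
* `K_y = y/(1 − ypq)`: `∂ₛK_y = 0`.

All denominators are `≥ min(1 − x, 1 − y) > 0` on the closed cube, so the functions are regular there;
the partial derivatives are computed symbolically (`rfun_pd_fn_eq`). Part 2 supplies the logarithmic
term and part 3 assembles the chain. References: M. Kontsevich, D. Zagier, *Periods* (2001), §1.2
[cite: KontsevichZagier2001, §1.2]; D. Zagier, *The dilogarithm function* (2007), Ch. I §2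
[cite: Zagier2007Dilogarithm, Ch. I §2]. No definitions are introduced.
-/

noncomputable section

open MeasureTheory Set MvPolynomial

namespace Summit.KontsevichZagierPeriods.HermiteRigidity.ReductionRigidity

open Literature.NumberTheory.Transcendental
open Literature.NumberTheory.Transcendental.KZ

/-! ## Bounds on the closed cube `□³` -/

/-- Products of coordinates of a point of `□³` lie in `[0,1]`. [folklore] -/
theorem fiveTerm_cube_bounds {p : Fin 3 → ℝ} (hp : p ∈ cube 3) :
    (0 ≤ p 0 ∧ p 0 ≤ 1) ∧ (0 ≤ p 1 ∧ p 1 ≤ 1) ∧ (0 ≤ p 2 ∧ p 2 ≤ 1) ∧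
      (0 ≤ p 0 * p 1 ∧ p 0 * p 1 ≤ 1) ∧ (0 ≤ p 2 * p 0 * p 1 ∧ p 2 * p 0 * p 1 ≤ 1) := by
  have h0 := hp 0; have h1 := hp 1; have h2 := hp 2
  have h01 : 0 ≤ p 0 * p 1 ∧ p 0 * p 1 ≤ 1 := ⟨mul_nonneg h0.1 h1.1, mul_le_one₀ h0.2 h1.1 h1.2⟩
  refine ⟨h0, h1, h2, h01, ?_, ?_⟩
  · exact mul_nonneg (mul_nonneg h2.1 h0.1) h1.1
  · rw [mul_assoc]; exact mul_le_one₀ h2.2 h01.1 h01.2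

/-- The denominators of the dilogarithm kernels are positive on `□³` (`0 < x, y < 1`):
`1 − sxpq ≥ 1 − x`, `1 − sxypq ≥ 1 − x`, `1 − sxy ≥ 1 − x`, `D_A ≥ 1 − x`, `D_B ≥ 1 − y`,
`1 − ypq ≥ 1 − y`. [folklore] -/
theorem fiveTerm_den_pos {x y : ℚ} (hx : 0 < x) (hx1 : x < 1) (hy : 0 < y) (hy1 : y < 1)
    {p : Fin 3 → ℝ} (hp : p ∈ cube 3) :
    0 < 1 - (x:ℝ) * p 2 * p 0 * p 1 ∧ 0 < 1 - (x:ℝ) * y * p 2 * p 0 * p 1 ∧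
      0 < 1 - (x:ℝ) * y * p 2 ∧
      0 < 1 - (x:ℝ) * y * p 2 - (x:ℝ) * (1 - y) * p 2 * p 0 * p 1 ∧
      0 < 1 - (x:ℝ) * y * p 2 - (y:ℝ) * (1 - x * p 2) * p 0 * p 1 ∧
      0 < 1 - (y:ℝ) * p 0 * p 1 := by
  have hx' : (0:ℝ) < x := by exact_mod_cast hx
  have hx1' : (x:ℝ) < 1 := by exact_mod_cast hx1
  have hy' : (0:ℝ) < y := by exact_mod_cast hy
  have hy1' : (y:ℝ) < 1 := by exact_mod_cast hy1
  obtain ⟨h0, h1, h2, h01, h201⟩ := fiveTerm_cube_bounds hp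
  have t201 : p 2 * p 0 * p 1 ≤ 1 := h201.2
  have e1 : (x:ℝ) * p 2 * p 0 * p 1 ≤ x := by nlinarith
  have e2 : (x:ℝ) * y * p 2 * p 0 * p 1 ≤ x * y := by nlinarith [mul_pos hx' hy']
  have e3 : (x:ℝ) * y * p 2 ≤ x * y := by nlinarith [mul_pos hx' hy']
  have exy : (x:ℝ) * y < x := by nlinarith
  have e4 : (x:ℝ) * (1 - y) * p 2 * p 0 * p 1 ≤ x * (1 - y) := by
    nlinarith [mul_pos hx' (sub_pos.2 hy1')]
  have e5 : (y:ℝ) * (1 - x * p 2) * p 0 * p 1 ≤ y * (1 - x * p 2) := by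
    have hxp : 0 ≤ 1 - (x:ℝ) * p 2 := by nlinarith
    have := mul_nonneg hy'.le hxp
    nlinarith
  have e6 : (y:ℝ) * p 0 * p 1 ≤ y := by nlinarith
  refine ⟨by linarith, by linarith, by linarith, by nlinarith, by nlinarith, by linarith⟩

/-! ## The kernels and their primitives -/

/-- `K₁ = sx/(1 − sxpq)` on `□³`, with `∂ₛK₁ = x/(1 − sxpq)²`. [cite: KontsevichZagier2001, §1.1] -/
theorem exists_fiveTerm_K₁ {x y : ℚ} (hx : 0 < x) (hx1 : x < 1) (hy : 0 < y) (hy1 : y < 1) :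
    ∃ T : RFun 3,
      (∀ p ∈ cube 3, T.fn p = (x:ℝ) * p 2 / (1 - (x:ℝ) * p 2 * p 0 * p 1)) ∧
      (∀ p ∈ cube 3, (T.pd 2).fn p = (x:ℝ) / (1 - (x:ℝ) * p 2 * p 0 * p 1) ^ 2) := by
  have hden : ∀ p ∈ cube 3, aeval p (1 - C x * X 2 * X 0 * X 1 : MvPolynomial (Fin 3) ℚ) ≠ 0 := by
    intro p hp
    have h := (fiveTerm_den_pos hx hx1 hy hy1 hp).1
    simp only [map_sub, map_one, map_mul, aeval_C, aeval_X, eq_ratCast]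
    exact h.ne'
  refine ⟨⟨C x * X 2, _, hden⟩, fun p _ => ?_, fun p hp => ?_⟩
  · simp [RFun.fn_apply]
  · have hne := (fiveTerm_den_pos hx hx1 hy hy1 hp).1.ne'
    rw [rfun_pd_fn_eq]
    simp only [map_sub, map_one, map_mul, pderiv_mul, pderiv_C, pderiv_one, pderiv_X, aeval_C,
      aeval_X, eq_ratCast]
    norm_num [Pi.single_apply, Fin.ext_iff]
    field_simp
    ring

/-- `G₁ = xp/(1 − sxpq)` on `□³`, with `∂ₚG₁ = x/(1 − sxpq)²`. [cite: KontsevichZagier2001, §1.1] -/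
theorem exists_fiveTerm_G₁ {x y : ℚ} (hx : 0 < x) (hx1 : x < 1) (hy : 0 < y) (hy1 : y < 1) :
    ∃ T : RFun 3,
      (∀ p ∈ cube 3, T.fn p = (x:ℝ) * p 0 / (1 - (x:ℝ) * p 2 * p 0 * p 1)) ∧
      (∀ p ∈ cube 3, (T.pd 0).fn p = (x:ℝ) / (1 - (x:ℝ) * p 2 * p 0 * p 1) ^ 2) := by
  have hden : ∀ p ∈ cube 3, aeval p (1 - C x * X 2 * X 0 * X 1 : MvPolynomial (Fin 3) ℚ) ≠ 0 := by
    intro p hp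
    have h := (fiveTerm_den_pos hx hx1 hy hy1 hp).1
    simp only [map_sub, map_one, map_mul, aeval_C, aeval_X, eq_ratCast]
    exact h.ne'
  refine ⟨⟨C x * X 0, _, hden⟩, fun p _ => ?_, fun p hp => ?_⟩
  · simp [RFun.fn_apply]
  · have hne := (fiveTerm_den_pos hx hx1 hy hy1 hp).1.ne'
    rw [rfun_pd_fn_eq]
    simp only [map_sub, map_one, map_mul, pderiv_mul, pderiv_C, pderiv_one, pderiv_X, aeval_C,
      aeval_X, eq_ratCast]
    norm_num [Pi.single_apply, Fin.ext_iff]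
    field_simp
    ring

/-- `K_y = y/(1 − ypq)` on `□³` (no dependence on `s`): `∂ₛK_y = 0`. [cite: KontsevichZagier2001, §1.1] -/
theorem exists_fiveTerm_Ky {x y : ℚ} (hx : 0 < x) (hx1 : x < 1) (hy : 0 < y) (hy1 : y < 1) :
    ∃ T : RFun 3,
      (∀ p ∈ cube 3, T.fn p = (y:ℝ) / (1 - (y:ℝ) * p 0 * p 1)) ∧
      (∀ p ∈ cube 3, (T.pd 2).fn p = 0) := by
  have hden : ∀ p ∈ cube 3, aeval p (1 - C y * X 0 * X 1 : MvPolynomial (Fin 3) ℚ) ≠ 0 := by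
    intro p hp
    have h := (fiveTerm_den_pos hx hx1 hy hy1 hp).2.2.2.2.2
    simp only [map_sub, map_one, map_mul, aeval_C, aeval_X, eq_ratCast]
    exact h.ne'
  refine ⟨⟨C y, _, hden⟩, fun p _ => ?_, fun p hp => ?_⟩
  · simp [RFun.fn_apply]
  · rw [rfun_pd_fn_eq]
    simp only [map_sub, map_one, map_mul, pderiv_mul, pderiv_C, pderiv_one, pderiv_X, aeval_C,
      aeval_X, eq_ratCast]
    norm_num [Pi.single_apply, Fin.ext_iff]

/-- `K₂ = sxy/(1 − sxypq)` on `□³`, with `∂ₛK₂ = xy/(1 − sxypq)²`. [cite: KontsevichZagier2001, §1.1] -/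
theorem exists_fiveTerm_K₂ {x y : ℚ} (hx : 0 < x) (hx1 : x < 1) (hy : 0 < y) (hy1 : y < 1) :
    ∃ T : RFun 3,
      (∀ p ∈ cube 3, T.fn p = (x:ℝ) * y * p 2 / (1 - (x:ℝ) * y * p 2 * p 0 * p 1)) ∧
      (∀ p ∈ cube 3, (T.pd 2).fn p = (x:ℝ) * y / (1 - (x:ℝ) * y * p 2 * p 0 * p 1) ^ 2) := by
  have hden : ∀ p ∈ cube 3,
      aeval p (1 - C (x * y) * X 2 * X 0 * X 1 : MvPolynomial (Fin 3) ℚ) ≠ 0 := by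
    intro p hp
    have h := (fiveTerm_den_pos hx hx1 hy hy1 hp).2.1
    simp only [map_sub, map_one, map_mul, aeval_C, aeval_X, eq_ratCast]
    exact h.ne'
  refine ⟨⟨C (x * y) * X 2, _, hden⟩, fun p _ => ?_, fun p hp => ?_⟩
  · simp [RFun.fn_apply]
  · have hne := (fiveTerm_den_pos hx hx1 hy hy1 hp).2.1.ne'
    rw [rfun_pd_fn_eq]
    simp only [map_sub, map_one, map_mul, pderiv_mul, pderiv_C, pderiv_one, pderiv_X, aeval_C,
      aeval_X, eq_ratCast]
    norm_num [Pi.single_apply, Fin.ext_iff]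
    field_simp
    ring

/-- `G₂ = xyp/(1 − sxypq)` on `□³`, with `∂ₚG₂ = xy/(1 − sxypq)²`. [cite: KontsevichZagier2001, §1.1] -/
theorem exists_fiveTerm_G₂ {x y : ℚ} (hx : 0 < x) (hx1 : x < 1) (hy : 0 < y) (hy1 : y < 1) :
    ∃ T : RFun 3,
      (∀ p ∈ cube 3, T.fn p = (x:ℝ) * y * p 0 / (1 - (x:ℝ) * y * p 2 * p 0 * p 1)) ∧
      (∀ p ∈ cube 3, (T.pd 0).fn p = (x:ℝ) * y / (1 - (x:ℝ) * y * p 2 * p 0 * p 1) ^ 2) := by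
  have hden : ∀ p ∈ cube 3,
      aeval p (1 - C (x * y) * X 2 * X 0 * X 1 : MvPolynomial (Fin 3) ℚ) ≠ 0 := by
    intro p hp
    have h := (fiveTerm_den_pos hx hx1 hy hy1 hp).2.1
    simp only [map_sub, map_one, map_mul, aeval_C, aeval_X, eq_ratCast]
    exact h.ne'
  refine ⟨⟨C (x * y) * X 0, _, hden⟩, fun p _ => ?_, fun p hp => ?_⟩
  · simp [RFun.fn_apply]
  · have hne := (fiveTerm_den_pos hx hx1 hy hy1 hp).2.1.ne'
    rw [rfun_pd_fn_eq]
    simp only [map_sub, map_one, map_mul, pderiv_mul, pderiv_C, pderiv_one, pderiv_X, aeval_C,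
      aeval_X, eq_ratCast]
    norm_num [Pi.single_apply, Fin.ext_iff]
    field_simp
    ring

/-- `K_A = sx(1−y)/D_A` on `□³` (`D_A = 1 − sxy − sx(1−y)pq`), the kernel of `Li₂(A(s))`,
`A(s) = sx(1−y)/(1−sxy)`, with `∂ₛK_A = x(1−y)/D_A²`. [cite: KontsevichZagier2001, §1.1] -/
theorem exists_fiveTerm_KA {x y : ℚ} (hx : 0 < x) (hx1 : x < 1) (hy : 0 < y) (hy1 : y < 1) :
    ∃ T : RFun 3,
      (∀ p ∈ cube 3, T.fn p = (x:ℝ) * (1 - y) * p 2 /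
        (1 - (x:ℝ) * y * p 2 - (x:ℝ) * (1 - y) * p 2 * p 0 * p 1)) ∧
      (∀ p ∈ cube 3, (T.pd 2).fn p = (x:ℝ) * (1 - y) /
        (1 - (x:ℝ) * y * p 2 - (x:ℝ) * (1 - y) * p 2 * p 0 * p 1) ^ 2) := by
  have hden : ∀ p ∈ cube 3, aeval p
      (1 - C (x * y) * X 2 - C (x * (1 - y)) * X 2 * X 0 * X 1 : MvPolynomial (Fin 3) ℚ) ≠ 0 := by
    intro p hp
    have h := (fiveTerm_den_pos hx hx1 hy hy1 hp).2.2.2.1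
    simp only [map_sub, map_one, map_mul, aeval_C, aeval_X, eq_ratCast]
    exact h.ne'
  refine ⟨⟨C (x * (1 - y)) * X 2, _, hden⟩, fun p _ => ?_, fun p hp => ?_⟩
  · simp [RFun.fn_apply]
  · have hne := (fiveTerm_den_pos hx hx1 hy hy1 hp).2.2.2.1.ne'
    rw [rfun_pd_fn_eq]
    simp only [map_sub, map_one, map_mul, pderiv_mul, pderiv_C, pderiv_one, pderiv_X, aeval_C,
      aeval_X, eq_ratCast]
    norm_num [Pi.single_apply, Fin.ext_iff]
    field_simp
    ring

/-- `G_A = x(1−y)p/((1 − sxy)D_A)` on `□³`, with `∂ₚG_A = x(1−y)/D_A²` (`A′(s) = x(1−y)/(1−sxy)²`).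
[cite: KontsevichZagier2001, §1.1] -/
theorem exists_fiveTerm_GA {x y : ℚ} (hx : 0 < x) (hx1 : x < 1) (hy : 0 < y) (hy1 : y < 1) :
    ∃ T : RFun 3,
      (∀ p ∈ cube 3, T.fn p = (x:ℝ) * (1 - y) * p 0 /
        ((1 - (x:ℝ) * y * p 2) * (1 - (x:ℝ) * y * p 2 - (x:ℝ) * (1 - y) * p 2 * p 0 * p 1))) ∧
      (∀ p ∈ cube 3, (T.pd 0).fn p = (x:ℝ) * (1 - y) /
        (1 - (x:ℝ) * y * p 2 - (x:ℝ) * (1 - y) * p 2 * p 0 * p 1) ^ 2) := by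
  have hden : ∀ p ∈ cube 3, aeval p
      ((1 - C (x * y) * X 2) * (1 - C (x * y) * X 2 - C (x * (1 - y)) * X 2 * X 0 * X 1) :
        MvPolynomial (Fin 3) ℚ) ≠ 0 := by
    intro p hp
    have h := fiveTerm_den_pos hx hx1 hy hy1 hp
    simp only [map_sub, map_one, map_mul, aeval_C, aeval_X, eq_ratCast]
    exact mul_ne_zero h.2.2.1.ne' h.2.2.2.1.ne'
  refine ⟨⟨C (x * (1 - y)) * X 0, _, hden⟩, fun p _ => ?_, fun p hp => ?_⟩
  · simp [RFun.fn_apply]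
  · have h := fiveTerm_den_pos hx hx1 hy hy1 hp
    have h1 := h.2.2.1.ne'
    have h2 := h.2.2.2.1.ne'
    rw [rfun_pd_fn_eq]
    simp only [map_sub, map_one, map_mul, pderiv_mul, pderiv_C, pderiv_one, pderiv_X, aeval_C,
      aeval_X, eq_ratCast]
    norm_num [Pi.single_apply, Fin.ext_iff]
    field_simp
    ring

/-- `K_B = y(1−sx)/D_B` on `□³` (`D_B = 1 − sxy − y(1−sx)pq`), the kernel of `Li₂(B(s))`,
`B(s) = y(1−sx)/(1−sxy)`, with `∂ₛK_B = −xy(1−y)/D_B²`. [cite: KontsevichZagier2001, §1.1] -/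
theorem exists_fiveTerm_KB {x y : ℚ} (hx : 0 < x) (hx1 : x < 1) (hy : 0 < y) (hy1 : y < 1) :
    ∃ T : RFun 3,
      (∀ p ∈ cube 3, T.fn p = (y:ℝ) * (1 - x * p 2) /
        (1 - (x:ℝ) * y * p 2 - (y:ℝ) * (1 - x * p 2) * p 0 * p 1)) ∧
      (∀ p ∈ cube 3, (T.pd 2).fn p = -((x:ℝ) * y * (1 - y)) /
        (1 - (x:ℝ) * y * p 2 - (y:ℝ) * (1 - x * p 2) * p 0 * p 1) ^ 2) := by
  have hden : ∀ p ∈ cube 3, aeval p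
      (1 - C (x * y) * X 2 - C y * (1 - C x * X 2) * X 0 * X 1 : MvPolynomial (Fin 3) ℚ) ≠ 0 := by
    intro p hp
    have h := (fiveTerm_den_pos hx hx1 hy hy1 hp).2.2.2.2.1
    simp only [map_sub, map_one, map_mul, aeval_C, aeval_X, eq_ratCast]
    exact h.ne'
  refine ⟨⟨C y * (1 - C x * X 2), _, hden⟩, fun p _ => ?_, fun p hp => ?_⟩
  · simp [RFun.fn_apply]
  · have hne := (fiveTerm_den_pos hx hx1 hy hy1 hp).2.2.2.2.1.ne'
    rw [rfun_pd_fn_eq]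
    simp only [map_sub, map_one, map_mul, pderiv_mul, pderiv_C, pderiv_one, pderiv_X, aeval_C,
      aeval_X, eq_ratCast]
    norm_num [Pi.single_apply, Fin.ext_iff]
    field_simp
    ring

/-- `G_B = −xy(1−y)p/((1 − sxy)D_B)` on `□³`, with `∂ₚG_B = −xy(1−y)/D_B²` (`B′(s) = −xy(1−y)/(1−sxy)²`).
[cite: KontsevichZagier2001, §1.1] -/
theorem exists_fiveTerm_GB {x y : ℚ} (hx : 0 < x) (hx1 : x < 1) (hy : 0 < y) (hy1 : y < 1) :
    ∃ T : RFun 3,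
      (∀ p ∈ cube 3, T.fn p = -((x:ℝ) * y * (1 - y) * p 0) /
        ((1 - (x:ℝ) * y * p 2) * (1 - (x:ℝ) * y * p 2 - (y:ℝ) * (1 - x * p 2) * p 0 * p 1))) ∧
      (∀ p ∈ cube 3, (T.pd 0).fn p = -((x:ℝ) * y * (1 - y)) /
        (1 - (x:ℝ) * y * p 2 - (y:ℝ) * (1 - x * p 2) * p 0 * p 1) ^ 2) := by
  have hden : ∀ p ∈ cube 3, aeval p
      ((1 - C (x * y) * X 2) * (1 - C (x * y) * X 2 - C y * (1 - C x * X 2) * X 0 * X 1) :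
        MvPolynomial (Fin 3) ℚ) ≠ 0 := by
    intro p hp
    have h := fiveTerm_den_pos hx hx1 hy hy1 hp
    simp only [map_sub, map_one, map_mul, aeval_C, aeval_X, eq_ratCast]
    exact mul_ne_zero h.2.2.1.ne' h.2.2.2.2.1.ne'
  refine ⟨⟨-(C (x * y * (1 - y)) * X 0), _, hden⟩, fun p _ => ?_, fun p hp => ?_⟩
  · simp [RFun.fn_apply]
  · have h := fiveTerm_den_pos hx hx1 hy hy1 hp
    have h1 := h.2.2.1.ne'
    have h2 := h.2.2.2.2.1.ne'
    rw [rfun_pd_fn_eq]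
    simp only [map_sub, map_one, map_mul, map_neg, pderiv_mul, pderiv_C, pderiv_one, pderiv_X,
      aeval_C, aeval_X, eq_ratCast]
    norm_num [Pi.single_apply, Fin.ext_iff]
    field_simp
    ring

/-! ## The registered sub-goal stub -/

/-- **Stub `stub_fiveTermDilogPrimitives`** (sub-goal of crux `ReductionRigidity`, stmt-3407, line
`Sketch`, growth deliverable G5, part 1): for rationals `0 < x, y < 1`, the dilogarithm kernels
`K₁, G₁, K_y, K₂, G₂, K_A, G_A, K_B, G_B` of the deformed five-term combination exist as regular
rational functions on `□³`, with the stated values and derivative values — in particular the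
exactness `∂ₛK₁ = ∂ₚG₁`, `∂ₛK₂ = ∂ₚG₂`, `∂ₛK_A = ∂ₚG_A`, `∂ₛK_B = ∂ₚG_B`, `∂ₛK_y = 0` pointwise on the
cube. [cite: KontsevichZagier2001, §1.2 rule (3)] -/
theorem stub_fiveTermDilogPrimitives :
    ∀ (x y : ℚ), 0 < x → x < 1 → 0 < y → y < 1 → ∃ K₁ G₁ Ky K₂ G₂ KA GA KB GB : RFun 3,
      (∀ p ∈ cube 3, K₁.fn p = (x:ℝ) * p 2 / (1 - (x:ℝ) * p 2 * p 0 * p 1)) ∧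
      (∀ p ∈ cube 3, (K₁.pd 2).fn p = (x:ℝ) / (1 - (x:ℝ) * p 2 * p 0 * p 1) ^ 2) ∧
      (∀ p ∈ cube 3, G₁.fn p = (x:ℝ) * p 0 / (1 - (x:ℝ) * p 2 * p 0 * p 1)) ∧
      (∀ p ∈ cube 3, (G₁.pd 0).fn p = (x:ℝ) / (1 - (x:ℝ) * p 2 * p 0 * p 1) ^ 2) ∧
      (∀ p ∈ cube 3, Ky.fn p = (y:ℝ) / (1 - (y:ℝ) * p 0 * p 1)) ∧
      (∀ p ∈ cube 3, (Ky.pd 2).fn p = 0) ∧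
      (∀ p ∈ cube 3, K₂.fn p = (x:ℝ) * y * p 2 / (1 - (x:ℝ) * y * p 2 * p 0 * p 1)) ∧
      (∀ p ∈ cube 3, (K₂.pd 2).fn p = (x:ℝ) * y / (1 - (x:ℝ) * y * p 2 * p 0 * p 1) ^ 2) ∧
      (∀ p ∈ cube 3, G₂.fn p = (x:ℝ) * y * p 0 / (1 - (x:ℝ) * y * p 2 * p 0 * p 1)) ∧
      (∀ p ∈ cube 3, (G₂.pd 0).fn p = (x:ℝ) * y / (1 - (x:ℝ) * y * p 2 * p 0 * p 1) ^ 2) ∧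
      (∀ p ∈ cube 3, KA.fn p = (x:ℝ) * (1 - y) * p 2 /
        (1 - (x:ℝ) * y * p 2 - (x:ℝ) * (1 - y) * p 2 * p 0 * p 1)) ∧
      (∀ p ∈ cube 3, (KA.pd 2).fn p = (x:ℝ) * (1 - y) /
        (1 - (x:ℝ) * y * p 2 - (x:ℝ) * (1 - y) * p 2 * p 0 * p 1) ^ 2) ∧
      (∀ p ∈ cube 3, GA.fn p = (x:ℝ) * (1 - y) * p 0 /
        ((1 - (x:ℝ) * y * p 2) * (1 - (x:ℝ) * y * p 2 - (x:ℝ) * (1 - y) * p 2 * p 0 * p 1))) ∧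
      (∀ p ∈ cube 3, (GA.pd 0).fn p = (x:ℝ) * (1 - y) /
        (1 - (x:ℝ) * y * p 2 - (x:ℝ) * (1 - y) * p 2 * p 0 * p 1) ^ 2) ∧
      (∀ p ∈ cube 3, KB.fn p = (y:ℝ) * (1 - x * p 2) /
        (1 - (x:ℝ) * y * p 2 - (y:ℝ) * (1 - x * p 2) * p 0 * p 1)) ∧
      (∀ p ∈ cube 3, (KB.pd 2).fn p = -((x:ℝ) * y * (1 - y)) /
        (1 - (x:ℝ) * y * p 2 - (y:ℝ) * (1 - x * p 2) * p 0 * p 1) ^ 2) ∧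
      (∀ p ∈ cube 3, GB.fn p = -((x:ℝ) * y * (1 - y) * p 0) /
        ((1 - (x:ℝ) * y * p 2) * (1 - (x:ℝ) * y * p 2 - (y:ℝ) * (1 - x * p 2) * p 0 * p 1))) ∧
      (∀ p ∈ cube 3, (GB.pd 0).fn p = -((x:ℝ) * y * (1 - y)) /
        (1 - (x:ℝ) * y * p 2 - (y:ℝ) * (1 - x * p 2) * p 0 * p 1) ^ 2) := by
  intro x y hx hx1 hy hy1
  obtain ⟨K₁, a₁, a₂⟩ := exists_fiveTerm_K₁ hx hx1 hy hy1
  obtain ⟨G₁, a₃, a₄⟩ := exists_fiveTerm_G₁ hx hx1 hy hy1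
  obtain ⟨Ky, a₅, a₆⟩ := exists_fiveTerm_Ky hx hx1 hy hy1
  obtain ⟨K₂, a₇, a₈⟩ := exists_fiveTerm_K₂ hx hx1 hy hy1
  obtain ⟨G₂, a₉, a₁₀⟩ := exists_fiveTerm_G₂ hx hx1 hy hy1
  obtain ⟨KA, a₁₁, a₁₂⟩ := exists_fiveTerm_KA hx hx1 hy hy1
  obtain ⟨GA, a₁₃, a₁₄⟩ := exists_fiveTerm_GA hx hx1 hy hy1
  obtain ⟨KB, a₁₅, a₁₆⟩ := exists_fiveTerm_KB hx hx1 hy hy1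
  obtain ⟨GB, a₁₇, a₁₈⟩ := exists_fiveTerm_GB hx hx1 hy hy1
  exact ⟨K₁, G₁, Ky, K₂, G₂, KA, GA, KB, GB, a₁, a₂, a₃, a₄, a₅, a₆, a₇, a₈, a₉, a₁₀, a₁₁, a₁₂, a₁₃,
    a₁₄, a₁₅, a₁₆, a₁₇, a₁₈⟩

end Summit.KontsevichZagierPeriods.HermiteRigidity.ReductionRigidity

end
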